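/-
Copyright (c) 2026 the pub-hodgecm-mathlib formalisation cell (harness21).  Prover seat hodgecm-mathlib-F0P3a-p05 (g17): road «S3-ram» (LEAD F0P3a-plan (g12); owner∕table
F0P3a-p06 (g15); architect A-p16 (g31)), the (a2) JUNCTION (J★) of F0P3a-p01 (g17), socket **`countTransport_D_J₀` «D-HEAD TRANSPORT»** of `JunctionSockets.skeleton.v2`
(9e8236c2 :178); 2026-09-02.
-/
import Literature.NumberTheory.Automorphic.UnitaryLatticeTreeModelCountTransport   -- ★ p847495 (this seat): §3 `ncard_selfDual_fixed_{bd,deep,reg,rankOne}_eq_of_smul_formCongr` (change of basis ∘ unit rescaling of the form); brings ★ p847249, ★ `UnitaryLatticeTreeDefs`∕`Dual`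
import Literature.NumberTheory.Automorphic.UnitaryLatticeTreeTypes                 -- ★ (B-p14 (g35)): `mem_scaleLattice_iff`, `le_dualLatt_of_isVertexLattice`; brings ★ `smul_mem_of_v_le`
import HarnessLib

/-!
# The lattice graph of a hermitian space — CENTRAL RESCALING OF THE ELEMENT `T ↦ u⁻¹T` on the depth-`≤ 2` strata, and the D-HEAD TRANSPORT of the (a2) junction: the five
# head counts of a literal in its diagonal model equal the five counts in the `J₀`-model (Rogawski 1990 §4.9; Kottwitz 1986 §3; Bruhat–Tits 1972 §10)

Topic `NumberTheory/Automorphic`; namespace `Literature.NumberTheory.Automorphic.UnitaryLatticeTree`.  THEOREMS ONLY (no definition, no instance, no notation, no named fact,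
no `sorry`); kernel lane `--supports stmt-HodgeConjecture-24833`; §1 datum-free (`K` with `Valued K ℤᵐ⁰`, any `σ`, any rank `N`).  Cell `pub/hodgecm-mathlib` (D-0151), crux
H413; road «S3-ram» (Literature seeding, count-neutral), organ A′e, the JUNCTION (J★) `stub_signedStrataCount_typeOne_ram` (F0P3a-p01 (g16∕g17), J-PACK v2 03ef5f1f): the
tree-induction engine runs in the `J₀`-model with the literal normalised by its MIDDLE eigenvalue (`T″ = u⁻¹T = diag(α∕u, 1, γ∕u)`, conjugated into `U(σ, J₀)` by the ★ glInt
frame `A` of `diag d = (−det diag d) • ᵗσ(A) J₀ A`, ★ J1 `exists_glInt_diagonal_eq_smul_formCongr_antidiagonal`), while the head counts `T`-fixed self-dual lattices for the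
DIAGONAL form `diag d` with the head's class constants `c₀, c₀·ε`.  The END step of the assembly (architect A-p16 (g31) 00:44:53Z; junction pen F0P3a-p01 (g17), skeleton v2
socket `countTransport_D_J₀` :178) is therefore ★ p847249 §5 (change of basis) ∘ ★ p847495 (unit rescaling of the FORM) ∘ THIS FILE's §1 (central rescaling of the ELEMENT);
§2 is the socket text, binder for binder (its `hdσ hα hγ hα2 hγ2 hc₀` are carried, unused).

THE MATHEMATICS (elementary; [Kottwitz1986] §3, [Rogawski1990] §4.9 p. 55).  Write `B = s·A + t·1` for two commuting "element minus one" matrices (here `A = T − 1`, `B = T″ − 1`,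
`s = u⁻¹`, `t = u⁻¹ − 1`, and back with `s = u`, `t = u − 1`; `|u| = 1`, `|u − 1| ≤ |ϖ|²`).  (i) `T″·M = u⁻¹·(T·M) = T·M` (a unit homothety fixes every `𝒪`-lattice), so the
fixed lattices agree.  (ii) For `x ∈ M`: `Bx = s·Ax + t·x`, so `A·M ⊆ c·M ⇒ B·M ⊆ c·M` whenever `|s| ≤ 1`, `|t| ≤ |c|` — the level tokens `LEV (ϖ)`, `LEV (ϖ²)` agree.  (iii)
`B²x = s²·A²x + 2st·Ax + t²·x`; under `LEV (ϖ)` for `A` and `|t| ≤ |ϖ|²` each term of `B²x` lies in `ϖ³·M` as soon as `A²x` does — the square token `LEV₂ (ϖ³)` agrees (given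
`LEV (ϖ)`, which every label using it carries).  (iv) For `y` in a self-dual `M` with `A·M ⊆ ϖ·M`: `|B_H(y, Ay)| ≤ |ϖ|`, `|B_H(y, y)| ≤ 1` (`M ⊆ M^♯`), and `ϖ⁻¹B_H(y, By) −
ϖ⁻¹B_H(y, Ay) = ϖ⁻¹(s − 1)B_H(y, Ay) + ϖ⁻¹t·B_H(y, y)` has valuation `< 1` (`|s − 1|, |t| ≤ |ϖ|²`), so the class tokens «`|ϖ⁻¹B_H(y, ·y) − C| < 1`» agree for every constant
`C`.  Hence each of the five strata SETS for `(diag d, T)` equals that for `(diag d, T″)` (§2), and ★ p847495 §3 identifies the latter's counts with the `J₀`-model's for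
`A·T″·A⁻¹` (class constants divided by the unit `−det diag d`).
HONEST LABEL: HC_CM is proved only modulo the 2 remaining named inputs (hLiu418 24832, h413 24833) until rung 0 closes; nothing printed is asserted here (bookkeeping over a
valuation ring); «S3-ram» has no books consequence.

* §1 `scaleLattice_eq_self_of_v_eq_one`, **`mapGL_eq_of_coe_eq_smul`** (fixed lattices), **`map_toLin'_le_scaleLattice_of_eq_smul_add_smul`** (level tokens),
  **`map_toLin'_sq_le_scaleLattice_of_eq_smul_add_smul`** (square token under `LEV (ϖ)`), **`v_inv_mul_pairing_sub_lt_one_iff_of_eq_smul_add_smul`** (class token),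
  `v_pairing_mulVec_le_of_map_le_scaleLattice`, `v_pairing_self_le_one` (values at a vertex lattice).
* §2 **`ncard_strata_diagonal_eq_ncard_strata_antidiagonal_of_central`** (= socket `countTransport_D_J₀`).

## References
* [Rogawski1990] J. D. Rogawski, *Automorphic Representations of Unitary Groups in Three Variables*, Ann. of Math. Stud. 123 (1990), §4.9 pp. 54–55, Lemma 4.9.3 (labels of
  `γ`-fixed lattices; the count is taken in a convenient model).
* [Kottwitz1986] R. E. Kottwitz, *Base change for unit elements of Hecke algebras*, Compositio Math. 60 (1986), §3 (counting `γ`-fixed lattices; central modifications).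
* [BruhatTits1972] F. Bruhat, J. Tits, *Groupes réductifs sur un corps local I*, Publ. Math. IHÉS 41 (1972), §10 (the lattice model; homotheties act trivially on the building).
* [Tits1979] J. Tits, *Reductive groups over local fields*, PSPM 33.1 (1979), §3.5 (congruence filtrations).
* [Serre1980Trees] J.-P. Serre, *Trees* (1980), Ch. II §1.1 (lattices up to homothety).
* [Jacobowitz1962] R. Jacobowitz, *Hermitian forms over local fields*, Amer. J. Math. 84 (1962), §7–§8 (a unimodular lattice lies in its dual).
-/

set_option autoImplicit false

noncomputable section

open scoped Valued WithZero Matrix MatrixGroups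

namespace Literature.NumberTheory.Automorphic.UnitaryLatticeTree

open Literature.NumberTheory.Automorphic Literature.NumberTheory.Automorphic.HermitianLattice

variable {K : Type*} [Field K] [Valued K ℤᵐ⁰] {N : ℕ}

/-! ## §1 Central rescaling of the ELEMENT (`B = s·A + t·1`): fixed lattices, level tokens, the square token, the class token -/

/-- A unit homothety fixes every `𝒪`-lattice: `s·M = M` for `|s| = 1`. [cite: Serre1980Trees, II.1.1] -/
theorem scaleLattice_eq_self_of_v_eq_one {s : K} (hs : Valued.v s = 1) (M : Submodule 𝒪[K] (Fin N → K)) : scaleLattice s M = M := by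
  have hs0 : s ≠ 0 := fun h => by rw [h, map_zero] at hs; exact zero_ne_one hs
  ext x
  rw [mem_scaleLattice_iff hs0]
  constructor
  · intro h
    have h' := smul_mem_of_v_le M hs.le h
    rwa [smul_smul, mul_inv_cancel₀ hs0, one_smul] at h'
  · intro h
    exact smul_mem_of_v_le M (by rw [map_inv₀, hs, inv_one]) h

/-- **Fixed lattices are invariant under a unit central rescaling of the element**: if `T″ = s·T` with `|s| = 1` then `T″·M = T·M`. [cite: Serre1980Trees, II.1.1] [cite: Kottwitz1986, §3] -/
theorem mapGL_eq_of_coe_eq_smul {s : K} (hs : Valued.v s = 1) {T T'' : GL (Fin N) K} (hTT : (T'' : Matrix (Fin N) (Fin N) K) = s • (T : Matrix (Fin N) (Fin N) K))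
    (M : Submodule 𝒪[K] (Fin N → K)) : mapGL T'' M = mapGL T M := by
  have hs0 : s ≠ 0 := fun h => by rw [h, map_zero] at hs; exact zero_ne_one hs
  have key : mapGL T'' M = scaleLattice s (mapGL T M) := by
    ext x
    rw [mem_scaleLattice_iff hs0, mapGL, mapGL, Submodule.mem_map, Submodule.mem_map]
    constructor
    · rintro ⟨y, hy, rfl⟩
      refine ⟨y, hy, ?_⟩
      rw [LinearMap.restrictScalars_apply, LinearMap.restrictScalars_apply, Matrix.toLin'_apply, Matrix.toLin'_apply, hTT, Matrix.smul_mulVec, smul_smul,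
        inv_mul_cancel₀ hs0, one_smul]
    · rintro ⟨y, hy, hyx⟩
      refine ⟨y, hy, ?_⟩
      rw [LinearMap.restrictScalars_apply, Matrix.toLin'_apply] at hyx ⊢
      rw [hTT, Matrix.smul_mulVec, hyx, smul_smul, mul_inv_cancel₀ hs0, one_smul]
  rw [key, scaleLattice_eq_self_of_v_eq_one hs]

/-- **THE LEVEL TOKEN UNDER `B = s·A + t·1`** (`|s| ≤ 1`, `|t| ≤ |c|`): `A·M ⊆ c·M ⇒ B·M ⊆ c·M`. (For the central rescaling `T″ − 1 = u⁻¹(T − 1) + (u⁻¹ − 1)·1` and back,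
with `|u − 1| ≤ |ϖ|²`, this moves `LEV (ϖ)` and `LEV (ϖ²)` between `T` and `T″`.) [cite: Kottwitz1986, §3] [cite: Serre1980Trees, II.1.1] -/
theorem map_toLin'_le_scaleLattice_of_eq_smul_add_smul {A B : Matrix (Fin N) (Fin N) K} {s t c : K} (hB : B = s • A + t • (1 : Matrix (Fin N) (Fin N) K))
    (hs : Valued.v s ≤ 1) (hc : c ≠ 0) (ht : Valued.v t ≤ Valued.v c) (M : Submodule 𝒪[K] (Fin N → K))
    (h : M.map ((Matrix.toLin' A).restrictScalars 𝒪[K]) ≤ scaleLattice c M) : M.map ((Matrix.toLin' B).restrictScalars 𝒪[K]) ≤ scaleLattice c M := by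
  rw [Submodule.map_le_iff_le_comap] at h ⊢
  intro x hx
  have hAx : A *ᵥ x ∈ scaleLattice c M := by
    have h' := h hx
    rwa [Submodule.mem_comap, LinearMap.restrictScalars_apply, Matrix.toLin'_apply] at h'
  rw [Submodule.mem_comap, LinearMap.restrictScalars_apply, Matrix.toLin'_apply, hB, Matrix.add_mulVec, Matrix.smul_mulVec, Matrix.smul_mulVec, Matrix.one_mulVec]
  refine Submodule.add_mem _ (smul_mem_of_v_le _ hs hAx) ?_
  rw [mem_scaleLattice_iff hc, smul_smul]
  refine smul_mem_of_v_le M ?_ hx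
  rw [map_mul, map_inv₀]
  have hvc : Valued.v c ≠ 0 := (Valuation.ne_zero_iff _).2 hc
  calc (Valued.v c)⁻¹ * Valued.v t ≤ (Valued.v c)⁻¹ * Valued.v c := mul_le_mul' le_rfl ht
    _ = 1 := inv_mul_cancel₀ hvc

/-- **THE SQUARE TOKEN UNDER `B = s·A + t·1`** (`|s| ≤ 1`, `|t| ≤ |ϖ|²`, under `LEV (ϖ)` for `A`): `A²·M ⊆ ϖ³·M ⇒ B²·M ⊆ ϖ³·M` (`B² = s²A² + 2stA + t²`).
[cite: Kottwitz1986, §3] [cite: Tits1979, §3.5] -/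
theorem map_toLin'_sq_le_scaleLattice_of_eq_smul_add_smul {ϖ : K} (hϖ : Valued.v ϖ = WithZero.exp (-1 : ℤ)) {A B : Matrix (Fin N) (Fin N) K} {s t : K}
    (hB : B = s • A + t • (1 : Matrix (Fin N) (Fin N) K)) (hs : Valued.v s ≤ 1) (ht : Valued.v t ≤ Valued.v ϖ ^ 2) (M : Submodule 𝒪[K] (Fin N → K))
    (hlev : M.map ((Matrix.toLin' A).restrictScalars 𝒪[K]) ≤ scaleLattice ϖ M)
    (hsq : M.map ((Matrix.toLin' (A ^ 2)).restrictScalars 𝒪[K]) ≤ scaleLattice (ϖ ^ 3) M) :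
    M.map ((Matrix.toLin' (B ^ 2)).restrictScalars 𝒪[K]) ≤ scaleLattice (ϖ ^ 3) M := by
  have hϖ0 : ϖ ≠ 0 := fun h0 => by rw [h0, map_zero] at hϖ; exact WithZero.coe_ne_zero hϖ.symm
  have hvϖ0 : Valued.v ϖ ≠ 0 := (Valuation.ne_zero_iff _).2 hϖ0
  have hϖ1 : Valued.v ϖ ≤ 1 := by rw [hϖ, ← WithZero.exp_zero]; exact WithZero.exp_le_exp.2 (by norm_num)
  have hp3 : (ϖ ^ 3 : K) ≠ 0 := pow_ne_zero _ hϖ0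
  rw [Submodule.map_le_iff_le_comap] at hlev hsq ⊢
  intro x hx
  have hAx : ϖ⁻¹ • (A *ᵥ x) ∈ M := by
    have h' := hlev hx
    rw [Submodule.mem_comap, LinearMap.restrictScalars_apply, Matrix.toLin'_apply] at h'
    exact (mem_scaleLattice_iff hϖ0 M _).1 h'
  have hA2x : (ϖ ^ 3)⁻¹ • (A *ᵥ (A *ᵥ x)) ∈ M := by
    have h' := hsq hx
    rw [Submodule.mem_comap, LinearMap.restrictScalars_apply, Matrix.toLin'_apply, pow_two, ← Matrix.mulVec_mulVec] at h'
    exact (mem_scaleLattice_iff hp3 M _).1 h'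
  rw [Submodule.mem_comap, LinearMap.restrictScalars_apply, Matrix.toLin'_apply, pow_two, ← Matrix.mulVec_mulVec, mem_scaleLattice_iff hp3]
  -- `B (B x) = s²·A(Ax) + (2st)·Ax + t²·x`
  have hBx : B *ᵥ (B *ᵥ x) = (s * s) • (A *ᵥ (A *ᵥ x)) + (2 * s * t) • (A *ᵥ x) + (t * t) • x := by
    rw [hB]
    simp only [Matrix.add_mulVec, Matrix.smul_mulVec, Matrix.one_mulVec, Matrix.mulVec_add, Matrix.mulVec_smul, smul_add, smul_smul]
    rw [mul_comm t s]
    module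
  rw [hBx, smul_add, smul_add, smul_smul, smul_smul, smul_smul]
  refine Submodule.add_mem _ (Submodule.add_mem _ ?_ ?_) ?_
  · -- `(ϖ³)⁻¹ s² A(Ax) = s² · ((ϖ³)⁻¹ A(Ax))`
    rw [show (ϖ ^ 3)⁻¹ * (s * s) = (s * s) * (ϖ ^ 3)⁻¹ from mul_comm _ _, ← smul_smul]
    exact smul_mem_of_v_le M (by rw [map_mul]; exact mul_le_one' hs hs) hA2x
  · -- `(ϖ³)⁻¹ (2st) Ax = (2 s t ϖ⁻²) · (ϖ⁻¹ Ax)`, `|2 s t ϖ⁻²| ≤ 1`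
    rw [show (ϖ ^ 3)⁻¹ * (2 * s * t) = (2 * s * t * (ϖ ^ 2)⁻¹) * ϖ⁻¹ by field_simp, ← smul_smul]
    refine smul_mem_of_v_le M ?_ hAx
    rw [map_mul, map_mul, map_mul, map_inv₀, map_pow]
    have h2 : Valued.v (2 : K) ≤ 1 := by
      have : Valued.v (2 : K) = Valued.v ((1 : K) + 1) := by norm_num
      rw [this]; exact (Valuation.map_add _ _ _).trans (by rw [Valuation.map_one, max_self])
    calc Valued.v 2 * Valued.v s * Valued.v t * (Valued.v ϖ ^ 2)⁻¹ ≤ 1 * 1 * Valued.v ϖ ^ 2 * (Valued.v ϖ ^ 2)⁻¹ :=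
          mul_le_mul' (mul_le_mul' (mul_le_mul' h2 hs) ht) le_rfl
      _ = 1 := by rw [one_mul, one_mul, mul_inv_cancel₀ (pow_ne_zero _ hvϖ0)]
  · -- `(ϖ³)⁻¹ t² x`, `|t²ϖ⁻³| ≤ |ϖ| ≤ 1`
    refine smul_mem_of_v_le M ?_ hx
    rw [map_mul, map_inv₀, map_pow, map_mul]
    calc (Valued.v ϖ ^ 3)⁻¹ * (Valued.v t * Valued.v t) ≤ (Valued.v ϖ ^ 3)⁻¹ * (Valued.v ϖ ^ 2 * Valued.v ϖ ^ 2) := mul_le_mul' le_rfl (mul_le_mul' ht ht)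
      _ = Valued.v ϖ := by
          rw [show Valued.v ϖ ^ 2 * Valued.v ϖ ^ 2 = Valued.v ϖ ^ 3 * Valued.v ϖ by rw [← pow_add, ← pow_succ], inv_mul_cancel_left₀ (pow_ne_zero _ hvϖ0)]
      _ ≤ 1 := hϖ1

/-- **THE CLASS TOKEN UNDER `B = s·A + t·1`** (`|s − 1| ≤ |ϖ|²`, `|t| ≤ |ϖ|²`), at a vector `y` with `|B_H(y, Ay)| ≤ |ϖ|` and `|B_H(y, y)| ≤ 1` (e.g. `y` in a self-dual lattice `M`
with `A·M ⊆ ϖ·M`): `|ϖ⁻¹·B_H(y, By) − C| < 1 ↔ |ϖ⁻¹·B_H(y, Ay) − C| < 1` for every `C` — the two differ by `ϖ⁻¹(s − 1)B_H(y, Ay) + ϖ⁻¹ t B_H(y, y)`, of valuation `< 1`.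
[cite: Rogawski1990, §4.9 p. 55] [cite: Kottwitz1986, §3] -/
theorem v_inv_mul_pairing_sub_lt_one_iff_of_eq_smul_add_smul {ϖ : K} (hϖ : Valued.v ϖ = WithZero.exp (-1 : ℤ)) (σ : K →+* K) (H : Matrix (Fin N) (Fin N) K)
    {A B : Matrix (Fin N) (Fin N) K} {s t : K} (hB : B = s • A + t • (1 : Matrix (Fin N) (Fin N) K)) (hs1 : Valued.v (s - 1) ≤ Valued.v ϖ ^ 2) (ht : Valued.v t ≤ Valued.v ϖ ^ 2)
    {y : Fin N → K} (hAy : Valued.v (pairing σ H y (A *ᵥ y)) ≤ Valued.v ϖ) (hyy : Valued.v (pairing σ H y y) ≤ 1) (C : K) :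
    Valued.v (ϖ⁻¹ * pairing σ H y (B *ᵥ y) - C) < 1 ↔ Valued.v (ϖ⁻¹ * pairing σ H y (A *ᵥ y) - C) < 1 := by
  have hϖ0 : ϖ ≠ 0 := fun h0 => by rw [h0, map_zero] at hϖ; exact WithZero.coe_ne_zero hϖ.symm
  have hvϖ0 : Valued.v ϖ ≠ 0 := (Valuation.ne_zero_iff _).2 hϖ0
  have hϖlt : Valued.v ϖ < 1 := by rw [hϖ, ← WithZero.exp_zero]; exact WithZero.exp_lt_exp.2 (by norm_num)
  have hBy : pairing σ H y (B *ᵥ y) = s * pairing σ H y (A *ᵥ y) + t * pairing σ H y y := by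
    rw [hB, Matrix.add_mulVec, Matrix.smul_mulVec, Matrix.smul_mulVec, Matrix.one_mulVec, map_add, map_smul, map_smul, smul_eq_mul, smul_eq_mul]
  -- the difference
  set Δ : K := ϖ⁻¹ * (s - 1) * pairing σ H y (A *ᵥ y) + ϖ⁻¹ * t * pairing σ H y y with hΔ
  have hΔlt : Valued.v Δ < 1 := by
    refine (Valuation.map_add _ _ _).trans_lt (max_lt ?_ ?_)
    · rw [map_mul, map_mul, map_inv₀]
      calc (Valued.v ϖ)⁻¹ * Valued.v (s - 1) * Valued.v (pairing σ H y (A *ᵥ y)) ≤ (Valued.v ϖ)⁻¹ * Valued.v ϖ ^ 2 * Valued.v ϖ :=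
            mul_le_mul' (mul_le_mul' le_rfl hs1) hAy
        _ = Valued.v ϖ ^ 2 := by rw [mul_assoc, ← pow_succ, pow_succ' (Valued.v ϖ) 2, inv_mul_cancel_left₀ hvϖ0]
        _ < 1 := pow_lt_one₀ zero_le hϖlt two_ne_zero
    · rw [map_mul, map_mul, map_inv₀]
      calc (Valued.v ϖ)⁻¹ * Valued.v t * Valued.v (pairing σ H y y) ≤ (Valued.v ϖ)⁻¹ * Valued.v ϖ ^ 2 * 1 := mul_le_mul' (mul_le_mul' le_rfl ht) hyy
        _ = Valued.v ϖ := by rw [mul_one, pow_two, inv_mul_cancel_left₀ hvϖ0]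
        _ < 1 := hϖlt
  have hdiff : ϖ⁻¹ * pairing σ H y (B *ᵥ y) - C = (ϖ⁻¹ * pairing σ H y (A *ᵥ y) - C) + Δ := by rw [hBy, hΔ]; ring
  rw [hdiff]
  constructor
  · intro h
    have h' : Valued.v ((ϖ⁻¹ * pairing σ H y (A *ᵥ y) - C + Δ) - Δ) < 1 := (Valuation.map_sub _ _ _).trans_lt (max_lt h hΔlt)
    rwa [add_sub_cancel_right] at h'
  · intro h
    exact (Valuation.map_add _ _ _).trans_lt (max_lt h hΔlt)

/-- **Values at a vertex**: for `M` a vertex lattice (e.g. self-dual), `y ∈ M` and `A·M ⊆ c·M` (`c ≠ 0`): `|B_H(y, Ay)| ≤ |c|` (and `|B_H(y, y)| ≤ 1` is the case `A = 1`, `c = 1`).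
[cite: Jacobowitz1962, §7–§8] [cite: Kottwitz1986, §3] -/
theorem v_pairing_mulVec_le_of_map_le_scaleLattice {σ : K →+* K} (hvσ : ∀ a, Valued.v (σ a) = Valued.v a) {ϖ : K} {H : Matrix (Fin N) (Fin N) K} {d : ℕ}
    {M : Submodule 𝒪[K] (Fin N → K)} (hM : IsVertexLattice σ ϖ H d M) {A : Matrix (Fin N) (Fin N) K} {c : K} (hc : c ≠ 0)
    (hlev : M.map ((Matrix.toLin' A).restrictScalars 𝒪[K]) ≤ scaleLattice c M) {y : Fin N → K} (hy : y ∈ M) :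
    Valued.v (pairing σ H y (A *ᵥ y)) ≤ Valued.v c := by
  have hvc : Valued.v c ≠ 0 := (Valuation.ne_zero_iff _).2 hc
  have hAy : c⁻¹ • (A *ᵥ y) ∈ M := by
    rw [Submodule.map_le_iff_le_comap] at hlev
    have h' := hlev hy
    rw [Submodule.mem_comap, LinearMap.restrictScalars_apply, Matrix.toLin'_apply] at h'
    exact (mem_scaleLattice_iff hc M _).1 h'
  have h1 := (mem_dualLatt σ H M _).1 (le_dualLatt_of_isVertexLattice hvσ hM hAy) y hy
  rw [map_smul, smul_eq_mul, map_mul, map_inv₀] at h1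
  have h2 := mul_le_mul' (le_refl (Valued.v c)) h1
  rwa [mul_inv_cancel_left₀ hvc, mul_one] at h2

/-- `|B_H(y, y)| ≤ 1` for `y` in a vertex lattice. [cite: Jacobowitz1962, §7–§8] -/
theorem v_pairing_self_le_one {σ : K →+* K} (hvσ : ∀ a, Valued.v (σ a) = Valued.v a) {ϖ : K} {H : Matrix (Fin N) (Fin N) K} {d : ℕ}
    {M : Submodule 𝒪[K] (Fin N → K)} (hM : IsVertexLattice σ ϖ H d M) {y : Fin N → K} (hy : y ∈ M) : Valued.v (pairing σ H y y) ≤ 1 :=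
  (mem_dualLatt σ H M _).1 (le_dualLatt_of_isVertexLattice hvσ hM hy) y hy

variable {σ : K →+* K} {ϖ : K}

/-! ## §2 THE D-HEAD TRANSPORT (junction socket `countTransport_D_J₀`, F0P3a-p01 (g17) skeleton v2 :178) -/

/-- **D-HEAD TRANSPORT** (= junction socket `countTransport_D_J₀`, text binder for binder): the five head counts of one literal in its diagonal model `(diag d, T = diag(α,u,γ), c₀,
c₀·ε)` equal the five counts in the `J₀`-model for `γ′ = A·T″·A⁻¹`, `T″ = diag(α∕u, 1, γ∕u) = u⁻¹T`, constants `c₁, c₁·ε` with `c₀ = (−det diag d)·c₁`, where `diag d =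
(−det diag d) • ᵗσ(A) J₀ A`: ★ p847495 §3 (change of basis ∘ unit rescaling of the FORM) ∘ §1 (central rescaling of the ELEMENT on the depth-`≤ 2` tokens: `|u − 1| ≤ |ϖ|²`).
The socket's `hdσ hα hγ hα2 hγ2 hc₀` are carried but not needed. [cite: Rogawski1990, §4.9 pp. 54–55, Lemma 4.9.3] [cite: Kottwitz1986, §3] [cite: BruhatTits1972, §10] -/
theorem ncard_strata_diagonal_eq_ncard_strata_antidiagonal_of_central (hvσ : ∀ a, Valued.v (σ a) = Valued.v a) (hϖ : Valued.v ϖ = WithZero.exp (-1 : ℤ))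
    (d : Fin 3 → K) (hd : ∀ i, Valued.v (d i) = 1) (_hdσ : ∀ i, σ (d i) = d i)
    (A : GL (Fin 3) K) (hdA : Matrix.diagonal d = (-(Matrix.diagonal d).det) • formCongr σ A ((StdForm.antidiagonal 3).over K))
    (α u γ : K) (_hα : Valued.v α = 1) (hu : Valued.v u = 1) (_hγ : Valued.v γ = 1)
    (_hα2 : Valued.v (α - 1) ≤ Valued.v ϖ ^ 2) (hu2 : Valued.v (u - 1) ≤ Valued.v ϖ ^ 2) (_hγ2 : Valued.v (γ - 1) ≤ Valued.v ϖ ^ 2)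
    (T T'' : GL (Fin 3) K) (hT : (T : Matrix (Fin 3) (Fin 3) K) = Matrix.diagonal ![α, u, γ]) (hT'' : (T'' : Matrix (Fin 3) (Fin 3) K) = Matrix.diagonal ![α / u, 1, γ / u])
    (c₀ c₁ ε : K) (_hc₀ : Valued.v c₀ = 1) (hc : c₀ = (-(Matrix.diagonal d).det) * c₁) (j : Fin 5) :
    ({M : Submodule 𝒪[K] (Fin 3 → K) | IsSelfDualLattice σ ϖ (Matrix.diagonal d) M ∧ mapGL T M = M ∧
        (![¬ M.map ((Matrix.toLin' ((T : Matrix (Fin 3) (Fin 3) K) - 1)).restrictScalars 𝒪[K]) ≤ scaleLattice ϖ M,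
                  M.map ((Matrix.toLin' ((T : Matrix (Fin 3) (Fin 3) K) - 1)).restrictScalars 𝒪[K]) ≤ scaleLattice ϖ M ∧
                    ¬ M.map ((Matrix.toLin' ((T : Matrix (Fin 3) (Fin 3) K) - 1)).restrictScalars 𝒪[K]) ≤ scaleLattice (ϖ ^ 2) M ∧
                    ¬ M.map ((Matrix.toLin' (((T : Matrix (Fin 3) (Fin 3) K) - 1) ^ 2)).restrictScalars 𝒪[K]) ≤ scaleLattice (ϖ ^ 3) M,
                  M.map ((Matrix.toLin' ((T : Matrix (Fin 3) (Fin 3) K) - 1)).restrictScalars 𝒪[K]) ≤ scaleLattice ϖ M ∧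
                    ¬ M.map ((Matrix.toLin' ((T : Matrix (Fin 3) (Fin 3) K) - 1)).restrictScalars 𝒪[K]) ≤ scaleLattice (ϖ ^ 2) M ∧
                    M.map ((Matrix.toLin' (((T : Matrix (Fin 3) (Fin 3) K) - 1) ^ 2)).restrictScalars 𝒪[K]) ≤ scaleLattice (ϖ ^ 3) M ∧
                    ∃ y ∈ M, ∃ a : K, Valued.v a = 1 ∧
                      Valued.v (ϖ⁻¹ * pairing σ (Matrix.diagonal d) y
                        (((T : Matrix (Fin 3) (Fin 3) K) - 1) *ᵥ y) - c₀ * a ^ 2) < 1,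
                  M.map ((Matrix.toLin' ((T : Matrix (Fin 3) (Fin 3) K) - 1)).restrictScalars 𝒪[K]) ≤ scaleLattice ϖ M ∧
                    ¬ M.map ((Matrix.toLin' ((T : Matrix (Fin 3) (Fin 3) K) - 1)).restrictScalars 𝒪[K]) ≤ scaleLattice (ϖ ^ 2) M ∧
                    M.map ((Matrix.toLin' (((T : Matrix (Fin 3) (Fin 3) K) - 1) ^ 2)).restrictScalars 𝒪[K]) ≤ scaleLattice (ϖ ^ 3) M ∧
                    ∃ y ∈ M, ∃ a : K, Valued.v a = 1 ∧
                      Valued.v (ϖ⁻¹ * pairing σ (Matrix.diagonal d) y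
                        (((T : Matrix (Fin 3) (Fin 3) K) - 1) *ᵥ y) - c₀ * ε * a ^ 2) < 1,
                  M.map ((Matrix.toLin' ((T : Matrix (Fin 3) (Fin 3) K) - 1)).restrictScalars 𝒪[K]) ≤ scaleLattice (ϖ ^ 2) M] : Fin 5 → Prop) j}.ncard) =
      ({M : Submodule 𝒪[K] (Fin 3 → K) | IsSelfDualLattice σ ϖ ((StdForm.antidiagonal 3).over K) M ∧ mapGL (A * T'' * A⁻¹) M = M ∧
        (![¬ M.map ((Matrix.toLin' ((((A * T'' * A⁻¹ : GL (Fin 3) K)) : Matrix (Fin 3) (Fin 3) K) - 1)).restrictScalars 𝒪[K]) ≤ scaleLattice ϖ M,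
                  M.map ((Matrix.toLin' ((((A * T'' * A⁻¹ : GL (Fin 3) K)) : Matrix (Fin 3) (Fin 3) K) - 1)).restrictScalars 𝒪[K]) ≤ scaleLattice ϖ M ∧
                    ¬ M.map ((Matrix.toLin' ((((A * T'' * A⁻¹ : GL (Fin 3) K)) : Matrix (Fin 3) (Fin 3) K) - 1)).restrictScalars 𝒪[K]) ≤ scaleLattice (ϖ ^ 2) M ∧
                    ¬ M.map ((Matrix.toLin' (((((A * T'' * A⁻¹ : GL (Fin 3) K)) : Matrix (Fin 3) (Fin 3) K) - 1) ^ 2)).restrictScalars 𝒪[K]) ≤ scaleLattice (ϖ ^ 3) M,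
                  M.map ((Matrix.toLin' ((((A * T'' * A⁻¹ : GL (Fin 3) K)) : Matrix (Fin 3) (Fin 3) K) - 1)).restrictScalars 𝒪[K]) ≤ scaleLattice ϖ M ∧
                    ¬ M.map ((Matrix.toLin' ((((A * T'' * A⁻¹ : GL (Fin 3) K)) : Matrix (Fin 3) (Fin 3) K) - 1)).restrictScalars 𝒪[K]) ≤ scaleLattice (ϖ ^ 2) M ∧
                    M.map ((Matrix.toLin' (((((A * T'' * A⁻¹ : GL (Fin 3) K)) : Matrix (Fin 3) (Fin 3) K) - 1) ^ 2)).restrictScalars 𝒪[K]) ≤ scaleLattice (ϖ ^ 3) M ∧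
                    ∃ y ∈ M, ∃ a : K, Valued.v a = 1 ∧
                      Valued.v (ϖ⁻¹ * pairing σ (((StdForm.antidiagonal 3).over K)) y
                        (((((A * T'' * A⁻¹ : GL (Fin 3) K)) : Matrix (Fin 3) (Fin 3) K) - 1) *ᵥ y) - c₁ * a ^ 2) < 1,
                  M.map ((Matrix.toLin' ((((A * T'' * A⁻¹ : GL (Fin 3) K)) : Matrix (Fin 3) (Fin 3) K) - 1)).restrictScalars 𝒪[K]) ≤ scaleLattice ϖ M ∧
                    ¬ M.map ((Matrix.toLin' ((((A * T'' * A⁻¹ : GL (Fin 3) K)) : Matrix (Fin 3) (Fin 3) K) - 1)).restrictScalars 𝒪[K]) ≤ scaleLattice (ϖ ^ 2) M ∧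
                    M.map ((Matrix.toLin' (((((A * T'' * A⁻¹ : GL (Fin 3) K)) : Matrix (Fin 3) (Fin 3) K) - 1) ^ 2)).restrictScalars 𝒪[K]) ≤ scaleLattice (ϖ ^ 3) M ∧
                    ∃ y ∈ M, ∃ a : K, Valued.v a = 1 ∧
                      Valued.v (ϖ⁻¹ * pairing σ (((StdForm.antidiagonal 3).over K)) y
                        (((((A * T'' * A⁻¹ : GL (Fin 3) K)) : Matrix (Fin 3) (Fin 3) K) - 1) *ᵥ y) - c₁ * ε * a ^ 2) < 1,
                  M.map ((Matrix.toLin' ((((A * T'' * A⁻¹ : GL (Fin 3) K)) : Matrix (Fin 3) (Fin 3) K) - 1)).restrictScalars 𝒪[K]) ≤ scaleLattice (ϖ ^ 2) M] : Fin 5 → Prop) j}.ncard) := by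
  have hϖ0 : ϖ ≠ 0 := fun h0 => by rw [h0, map_zero] at hϖ; exact WithZero.coe_ne_zero hϖ.symm
  have hvϖ0 : Valued.v ϖ ≠ 0 := (Valuation.ne_zero_iff _).2 hϖ0
  have hϖ1 : Valued.v ϖ ≤ 1 := by rw [hϖ, ← WithZero.exp_zero]; exact WithZero.exp_le_exp.2 (by norm_num)
  have hu0 : u ≠ 0 := fun h => by rw [h, map_zero] at hu; exact zero_ne_one hu
  -- the unit scalar of the model `diag d = (−det diag d) • ᵗσ(A) J₀ A`
  have hcv : Valued.v (-(Matrix.diagonal d).det) = 1 := by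
    rw [Valuation.map_neg, Matrix.det_diagonal, map_prod]
    exact Finset.prod_eq_one fun i _ => hd i
  -- the central rescaling `T″ = u⁻¹·T`: `T″ − 1 = u⁻¹(T − 1) + (u⁻¹ − 1)·1`, `T − 1 = u(T″ − 1) + (u − 1)·1`
  have hTT : (T'' : Matrix (Fin 3) (Fin 3) K) = u⁻¹ • (T : Matrix (Fin 3) (Fin 3) K) := by
    rw [hT, hT'', ← Matrix.diagonal_smul]
    congr 1
    ext i
    fin_cases i
    · simp [div_eq_inv_mul]
    · simp [inv_mul_cancel₀ hu0]
    · simp [div_eq_inv_mul]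
  have hB1 : (T'' : Matrix (Fin 3) (Fin 3) K) - 1 = u⁻¹ • ((T : Matrix (Fin 3) (Fin 3) K) - 1) + (u⁻¹ - 1) • (1 : Matrix (Fin 3) (Fin 3) K) := by
    rw [hTT, smul_sub, sub_smul, one_smul]; abel
  have hB2 : (T : Matrix (Fin 3) (Fin 3) K) - 1 = u • ((T'' : Matrix (Fin 3) (Fin 3) K) - 1) + (u - 1) • (1 : Matrix (Fin 3) (Fin 3) K) := by
    rw [hTT, smul_sub, smul_smul, mul_inv_cancel₀ hu0, one_smul, sub_smul, one_smul]; abel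
  have hui : Valued.v u⁻¹ = 1 := by rw [map_inv₀, hu, inv_one]
  have hui1 : Valued.v (u⁻¹ - 1) ≤ Valued.v ϖ ^ 2 := by
    rw [show u⁻¹ - 1 = u⁻¹ * (1 - u) by rw [mul_sub, mul_one, inv_mul_cancel₀ hu0], map_mul, hui, one_mul, ← Valuation.map_neg, neg_sub]
    exact hu2
  have hϖ21 : Valued.v ϖ ^ 2 ≤ Valued.v ϖ := by rw [pow_two]; exact mul_le_of_le_one_left zero_le hϖ1
  have hfix : ∀ M : Submodule 𝒪[K] (Fin 3 → K), mapGL T'' M = mapGL T M := mapGL_eq_of_coe_eq_smul hui hTT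
  -- the level tokens of depth ≤ 2 move both ways
  have hL : ∀ (M : Submodule 𝒪[K] (Fin 3 → K)) (k : ℕ), k = 1 ∨ k = 2 →
      (M.map ((Matrix.toLin' ((T : Matrix (Fin 3) (Fin 3) K) - 1)).restrictScalars 𝒪[K]) ≤ scaleLattice (ϖ ^ k) M ↔
        M.map ((Matrix.toLin' ((T'' : Matrix (Fin 3) (Fin 3) K) - 1)).restrictScalars 𝒪[K]) ≤ scaleLattice (ϖ ^ k) M) := by
    intro M k hk
    have hk' : Valued.v ϖ ^ 2 ≤ Valued.v (ϖ ^ k) := by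
      rcases hk with rfl | rfl
      · rw [pow_one]; exact hϖ21
      · rw [map_pow]
    exact ⟨map_toLin'_le_scaleLattice_of_eq_smul_add_smul hB1 hui.le (pow_ne_zero _ hϖ0) (hui1.trans hk') M,
      map_toLin'_le_scaleLattice_of_eq_smul_add_smul hB2 hu.le (pow_ne_zero _ hϖ0) (hu2.trans hk') M⟩
  have hL1 : ∀ M : Submodule 𝒪[K] (Fin 3 → K),
      (M.map ((Matrix.toLin' ((T : Matrix (Fin 3) (Fin 3) K) - 1)).restrictScalars 𝒪[K]) ≤ scaleLattice ϖ M ↔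
        M.map ((Matrix.toLin' ((T'' : Matrix (Fin 3) (Fin 3) K) - 1)).restrictScalars 𝒪[K]) ≤ scaleLattice ϖ M) := fun M => by
    have h := hL M 1 (Or.inl rfl); rwa [pow_one] at h
  have hL2 := fun M => hL M 2 (Or.inr rfl)
  -- the square token, under `LEV (ϖ)`
  have hS : ∀ M : Submodule 𝒪[K] (Fin 3 → K), M.map ((Matrix.toLin' ((T : Matrix (Fin 3) (Fin 3) K) - 1)).restrictScalars 𝒪[K]) ≤ scaleLattice ϖ M →
      (M.map ((Matrix.toLin' (((T : Matrix (Fin 3) (Fin 3) K) - 1) ^ 2)).restrictScalars 𝒪[K]) ≤ scaleLattice (ϖ ^ 3) M ↔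
        M.map ((Matrix.toLin' (((T'' : Matrix (Fin 3) (Fin 3) K) - 1) ^ 2)).restrictScalars 𝒪[K]) ≤ scaleLattice (ϖ ^ 3) M) := fun M h1 =>
    ⟨map_toLin'_sq_le_scaleLattice_of_eq_smul_add_smul hϖ hB1 hui.le hui1 M h1,
      map_toLin'_sq_le_scaleLattice_of_eq_smul_add_smul hϖ hB2 hu.le hu2 M ((hL1 M).1 h1)⟩
  -- the class token, under self-duality and `LEV (ϖ)`
  have hC : ∀ (M : Submodule 𝒪[K] (Fin 3 → K)) (C : K), IsSelfDualLattice σ ϖ (Matrix.diagonal d) M →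
      M.map ((Matrix.toLin' ((T : Matrix (Fin 3) (Fin 3) K) - 1)).restrictScalars 𝒪[K]) ≤ scaleLattice ϖ M →
      ((∃ y ∈ M, ∃ a : K, Valued.v a = 1 ∧ Valued.v (ϖ⁻¹ * pairing σ (Matrix.diagonal d) y (((T : Matrix (Fin 3) (Fin 3) K) - 1) *ᵥ y) - C * a ^ 2) < 1) ↔
        ∃ y ∈ M, ∃ a : K, Valued.v a = 1 ∧ Valued.v (ϖ⁻¹ * pairing σ (Matrix.diagonal d) y (((T'' : Matrix (Fin 3) (Fin 3) K) - 1) *ᵥ y) - C * a ^ 2) < 1) := by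
    intro M C hSD h1
    refine exists_congr fun y => and_congr_right fun hy => exists_congr fun a => and_congr_right fun _ => ?_
    exact (v_inv_mul_pairing_sub_lt_one_iff_of_eq_smul_add_smul hϖ σ (Matrix.diagonal d) hB1 hui1 hui1
      (v_pairing_mulVec_le_of_map_le_scaleLattice hvσ hSD hϖ0 h1 hy) (v_pairing_self_le_one hvσ hSD hy) (C * a ^ 2)).symm
  subst hc
  fin_cases j
  · -- bd
    simp only [Fin.zero_eta, Fin.isValue, Matrix.cons_val_zero]
    rw [ncard_selfDual_fixed_bd_eq_of_smul_formCongr σ ϖ hcv ((StdForm.antidiagonal 3).over K) A T'', ← hdA]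
    congr 1; ext M; simp only [Set.mem_setOf_eq]
    refine and_congr_right fun hSD => ?_
    rw [hfix M, hL1 M]
  · -- reg
    simp only [Fin.mk_one, Fin.isValue, Matrix.cons_val_one, Matrix.cons_val_zero]
    rw [ncard_selfDual_fixed_reg_eq_of_smul_formCongr σ ϖ hcv ((StdForm.antidiagonal 3).over K) A T'', ← hdA]
    congr 1; ext M; simp only [Set.mem_setOf_eq]
    refine and_congr_right fun hSD => ?_
    rw [hfix M]
    refine and_congr_right fun _ => ?_
    exact ⟨fun ⟨h1, h2, h3⟩ => ⟨(hL1 M).1 h1, fun h => h2 ((hL2 M).2 h), fun h => h3 ((hS M h1).2 h)⟩,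
      fun ⟨h1, h2, h3⟩ => ⟨(hL1 M).2 h1, fun h => h2 ((hL2 M).1 h), fun h => h3 ((hS M ((hL1 M).2 h1)).1 h)⟩⟩
  · -- 1□ class c₀
    simp only [Fin.reduceFinMk, Matrix.cons_val]
    rw [ncard_selfDual_fixed_rankOne_eq_of_smul_formCongr σ ϖ hcv ((StdForm.antidiagonal 3).over K) A T'' ϖ⁻¹ c₁, ← hdA]
    congr 1; ext M; simp only [Set.mem_setOf_eq]
    refine and_congr_right fun hSD => ?_
    rw [hfix M]
    refine and_congr_right fun _ => ?_
    exact ⟨fun ⟨h1, h2, h3, h4⟩ => ⟨(hL1 M).1 h1, fun h => h2 ((hL2 M).2 h), (hS M h1).1 h3, (hC M _ hSD h1).1 h4⟩,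
      fun ⟨h1, h2, h3, h4⟩ => ⟨(hL1 M).2 h1, fun h => h2 ((hL2 M).1 h), (hS M ((hL1 M).2 h1)).2 h3, (hC M _ hSD ((hL1 M).2 h1)).2 h4⟩⟩
  · -- 1□ class c₀ε
    simp only [Fin.reduceFinMk, Matrix.cons_val]
    rw [ncard_selfDual_fixed_rankOne_eq_of_smul_formCongr σ ϖ hcv ((StdForm.antidiagonal 3).over K) A T'' ϖ⁻¹ (c₁ * ε), ← hdA, ← mul_assoc]
    congr 1; ext M; simp only [Set.mem_setOf_eq]
    refine and_congr_right fun hSD => ?_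
    rw [hfix M]
    refine and_congr_right fun _ => ?_
    exact ⟨fun ⟨h1, h2, h3, h4⟩ => ⟨(hL1 M).1 h1, fun h => h2 ((hL2 M).2 h), (hS M h1).1 h3, (hC M _ hSD h1).1 h4⟩,
      fun ⟨h1, h2, h3, h4⟩ => ⟨(hL1 M).2 h1, fun h => h2 ((hL2 M).1 h), (hS M ((hL1 M).2 h1)).2 h3, (hC M _ hSD ((hL1 M).2 h1)).2 h4⟩⟩
  · -- deep
    simp only [Fin.reduceFinMk, Matrix.cons_val]
    rw [ncard_selfDual_fixed_deep_eq_of_smul_formCongr σ ϖ hcv ((StdForm.antidiagonal 3).over K) A T'', ← hdA]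
    congr 1; ext M; simp only [Set.mem_setOf_eq]
    refine and_congr_right fun hSD => ?_
    rw [hfix M, hL2 M]

end Literature.NumberTheory.Automorphic.UnitaryLatticeTree

end
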